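import Summits.CriticalPhenomena.CardyFormulaZ2.Theorems.CardySusyWardParafermionFamiliesToSLESixTouchLowerBoundI

/-!
# Touch lower bound on diagonal free walls (stub `stub_touchLowerBound`, reshape r2, of the line
# `exact-potential-schwarz-christoffel`, crux stmt-CriticalPhenomena-10814), J: the big circuit and the arm seen
# from the core

Helper file (deterministic bookkeeping in the diagonal coordinates level `a x + b y` / column `a x - b y`, `a, b = ±1`)
for the assembly of `stub_touchLowerBound`: the first centre `c₀` of the gluing chain is the point of column `t₀` and
level `c - w/2` under the flat piece of the free arc (`level_column_mk`), its nearest lattice site `v₀` has level and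
column pinned up to `2δ` (`level_column_nearest`); the big open circuit of `A(2m₀)` around `v₀` (`m₀ δ ≤ w/80`) stays
in the core band where lattice neighbours are `Ω_δ`-adjacent and off the discrete arcs (`mem_core_of_dist_le`); the
wall arm from a touch site `x` of level `k - 2` and column within `w/1000` of `t₀`, descending `3n` levels
(`n δ ≈ w/6`) inside a band of column half-width `≤ n/32`, stays in the core, ends inside the big circuit (within
`(2m₀ + 1) δ` of `δ v₀`) and starts outside it (farther than `3√2 (2m₀) δ`) (`arm_geometry`).
-/

noncomputable section

namespace Summit.CriticalPhenomena.CardyFormulaZ2.Theorems.ParafermionFamiliesToSLESix.TouchLowerBound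

open Set Metric Complex Filter MeasureTheory
open scoped Topology ENNReal
open Literature.Probability.LatticeModels Literature.Probability.Percolation
open Literature.Probability.RandomPlanarGeometry

/-! ## Coordinates -/

/-- The column separates points by at most twice their distance. [folklore] -/
theorem abs_column_sub_le {a b : ℤ} (ha : a = 1 ∨ a = -1) (hb : b = 1 ∨ b = -1) (p q : ℂ) :
    |((a : ℝ) * p.re - b * p.im) - ((a : ℝ) * q.re - b * q.im)| ≤ 2 * dist p q := by
  have h := abs_level_sub_le (a := a) (b := -b) ha (by rcases hb with rfl | rfl <;> norm_num) p q
  have e : ∀ z : ℂ, (a : ℝ) * z.re + ((-b : ℤ) : ℝ) * z.im = (a : ℝ) * z.re - b * z.im := fun z => by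
    push_cast; ring
  rw [e, e] at h
  exact h

/-- **The point of column `t` and level `ℓ`**: `(a (ℓ + t)/2, b (ℓ - t)/2)`. [folklore] -/
theorem level_column_mk {a b : ℤ} (ha : a = 1 ∨ a = -1) (hb : b = 1 ∨ b = -1) (t ℓ : ℝ) :
    (a : ℝ) * (⟨a * (ℓ + t) / 2, b * (ℓ - t) / 2⟩ : ℂ).re + b * (⟨a * (ℓ + t) / 2, b * (ℓ - t) / 2⟩ : ℂ).im = ℓ ∧
    (a : ℝ) * (⟨a * (ℓ + t) / 2, b * (ℓ - t) / 2⟩ : ℂ).re - b * (⟨a * (ℓ + t) / 2, b * (ℓ - t) / 2⟩ : ℂ).im = t := by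
  have ha2 : (a : ℝ) * a = 1 := by rcases ha with rfl | rfl <;> norm_num
  have hb2 : (b : ℝ) * b = 1 := by rcases hb with rfl | rfl <;> norm_num
  constructor
  · show (a : ℝ) * (a * (ℓ + t) / 2) + b * (b * (ℓ - t) / 2) = ℓ
    linear_combination ((ℓ + t) / 2) * ha2 + ((ℓ - t) / 2) * hb2
  · show (a : ℝ) * (a * (ℓ + t) / 2) - b * (b * (ℓ - t) / 2) = t
    linear_combination ((ℓ + t) / 2) * ha2 - ((ℓ - t) / 2) * hb2

/-- **Level and column of the nearest site of the first centre.** If `δ v₀` is within `δ` of the point `c₀` of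
column `t₀` and level `c - w/2`, then the level and the column of `v₀` are pinned up to `2δ`. [folklore] -/
theorem level_column_nearest {a b : ℤ} (ha : a = 1 ∨ a = -1) (hb : b = 1 ∨ b = -1) {δ c t₀ w : ℝ} {c₀ : ℂ}
    (hℓ : (a : ℝ) * c₀.re + b * c₀.im = c - w / 2) (hτ : (a : ℝ) * c₀.re - b * c₀.im = t₀) {v₀ : Site 2}
    (hv₀ : dist (meshPoint δ v₀) c₀ ≤ δ) :
    |δ * ((a * v₀ 0 + b * v₀ 1 : ℤ) : ℝ) - (c - w / 2)| ≤ 2 * δ ∧ |δ * ((a * v₀ 0 - b * v₀ 1 : ℤ) : ℝ) - t₀| ≤ 2 * δ := by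
  have h1 := abs_level_sub_le ha hb (meshPoint δ v₀) c₀
  have h2 := abs_column_sub_le ha hb (meshPoint δ v₀) c₀
  rw [level_meshPoint, hℓ] at h1
  rw [column_meshPoint, hτ] at h2
  exact ⟨h1.trans (by linarith), h2.trans (by linarith)⟩

/-! ## The big circuit and the arm, seen from the core -/

/-- **Sites near the first centre lie in the core**: a site within `9w/80` of `δ v₀` (the reach of the big
circuit) has column within `5w/8 - 2δ` of `t₀`, level at least `c - 3w/4 + 2δ` (mesh units) and at most `k - 2`.
[folklore] -/
theorem mem_core_of_dist_le {a b k : ℤ} {δ c t₀ w : ℝ} (ha : a = 1 ∨ a = -1) (hb : b = 1 ∨ b = -1) (hδ : 0 < δ)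
    (hk' : c ≤ δ * (k + 1)) (hδw : 400 * δ ≤ w) {v₀ : Site 2}
    (hℓv₀ : |δ * ((a * v₀ 0 + b * v₀ 1 : ℤ) : ℝ) - (c - w / 2)| ≤ 2 * δ)
    (hτv₀ : |δ * ((a * v₀ 0 - b * v₀ 1 : ℤ) : ℝ) - t₀| ≤ 2 * δ) {y : Site 2}
    (hy : dist (meshPoint δ y) (meshPoint δ v₀) ≤ 9 * w / 80) :
    |δ * ((a * y 0 - b * y 1 : ℤ) : ℝ) - t₀| ≤ 5 * w / 8 - 2 * δ ∧
      c - 3 * w / 4 + 2 * δ ≤ δ * ((a * y 0 + b * y 1 : ℤ) : ℝ) ∧ a * y 0 + b * y 1 ≤ k - 2 := by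
  have hℓ := abs_level_sub_le ha hb (meshPoint δ y) (meshPoint δ v₀)
  have hτ := abs_column_sub_le ha hb (meshPoint δ y) (meshPoint δ v₀)
  rw [level_meshPoint, level_meshPoint] at hℓ
  rw [column_meshPoint, column_meshPoint] at hτ
  rw [abs_le] at hℓ hτ hℓv₀ hτv₀
  refine ⟨abs_le.2 ⟨by linarith, by linarith⟩, by linarith, ?_⟩
  have h1 : δ * ((a * y 0 + b * y 1 : ℤ) : ℝ) < δ * ((k : ℝ) - 2) := by linarith
  have h2 : ((a * y 0 + b * y 1 : ℤ) : ℝ) < (k : ℝ) - 2 := lt_of_mul_lt_mul_left h1 hδ.le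
  have h3 : a * y 0 + b * y 1 < k - 2 := by exact_mod_cast h2
  exact h3.le

/-- **The arm seen from the core.** For a site `x` of level `k - 2` with column within `w/1000` of `t₀` and a band
of `3n` levels below `x` of column half-width `rr ≤ n/32` (`n δ ≈ w/6`): (i) the band lies in the core, (ii) its
bottom sites are within `(2m₀ + 1) δ` of `δ v₀` (`m₀ δ ≥ w/200 + 2δ`), (iii) `x` is farther than `3√2 (2m₀) δ` from
`δ v₀` (`m₀ δ ≤ w/80`). [folklore] -/
theorem arm_geometry {a b k : ℤ} {δ c t₀ w : ℝ} {n rr m₀ : ℕ} (ha : a = 1 ∨ a = -1) (hb : b = 1 ∨ b = -1)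
    (hδ : 0 < δ) (hk : δ * k < c) (hk' : c ≤ δ * (k + 1)) (hδw : 4000 * δ ≤ w) (hn6 : (n : ℝ) * δ ≤ w / 6)
    (hnlow : w / 6 - δ < n * δ) (hrr : 32 * rr ≤ n) (hm₀w : (m₀ : ℝ) * δ ≤ w / 2 / 40)
    (hm₀w' : w / 2 / 100 + 2 * δ ≤ m₀ * δ) {v₀ : Site 2}
    (hℓv₀ : |δ * ((a * v₀ 0 + b * v₀ 1 : ℤ) : ℝ) - (c - w / 2)| ≤ 2 * δ)
    (hτv₀ : |δ * ((a * v₀ 0 - b * v₀ 1 : ℤ) : ℝ) - t₀| ≤ 2 * δ) {x : Site 2} (hlx : a * x 0 + b * x 1 = k - 2)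
    (hτx : |δ * ((a * x 0 - b * x 1 : ℤ) : ℝ) - t₀| ≤ w / 1000) :
    ({v : Site 2 | |(a * v 0 - b * v 1) - (a * x 0 - b * x 1)| ≤ rr ∧ a * x 0 + b * x 1 - 3 * n ≤ a * v 0 + b * v 1 ∧
        a * v 0 + b * v 1 ≤ a * x 0 + b * x 1} ⊆
      {v : Site 2 | |δ * ((a * v 0 - b * v 1 : ℤ) : ℝ) - t₀| ≤ 5 * w / 8 - 2 * δ ∧
        c - 3 * w / 4 + 2 * δ ≤ δ * ((a * v 0 + b * v 1 : ℤ) : ℝ) ∧ a * v 0 + b * v 1 ≤ k - 2}) ∧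
    (∀ z : Site 2, |(a * z 0 - b * z 1) - (a * x 0 - b * x 1)| ≤ rr → a * z 0 + b * z 1 = a * x 0 + b * x 1 - 3 * n →
      dist (meshPoint δ z) (meshPoint δ v₀) < (((2 * m₀ : ℕ) : ℝ) + 1) * δ) ∧
    3 * Real.sqrt 2 * ((2 * m₀ : ℕ) : ℝ) * δ < dist (meshPoint δ x) (meshPoint δ v₀) := by
  -- column bookkeeping: a site within `rr` columns of `x` has its mesh column within `w/1000 + w/192` of `t₀`
  have hcol : ∀ v : Site 2, |(a * v 0 - b * v 1) - (a * x 0 - b * x 1)| ≤ rr →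
      |δ * ((a * v 0 - b * v 1 : ℤ) : ℝ) - t₀| ≤ w / 1000 + w / 192 := by
    intro v h1
    have hd : |((a * v 0 - b * v 1 : ℤ) : ℝ) - ((a * x 0 - b * x 1 : ℤ) : ℝ)| ≤ n / 32 := by
      rw [le_div_iff₀ (by norm_num)]
      have : ((32 * |(a * v 0 - b * v 1) - (a * x 0 - b * x 1)| : ℤ) : ℝ) ≤ n := by
        have h32 : 32 * |(a * v 0 - b * v 1) - (a * x 0 - b * x 1)| ≤ (n : ℤ) := by
          have := abs_nonneg ((a * v 0 - b * v 1) - (a * x 0 - b * x 1))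
          have hrr' : (32 * rr : ℤ) ≤ (n : ℤ) := by exact_mod_cast hrr
          nlinarith
        exact_mod_cast h32
      push_cast at this ⊢
      linarith
    have e : δ * ((a * v 0 - b * v 1 : ℤ) : ℝ) - t₀ = (δ * ((a * x 0 - b * x 1 : ℤ) : ℝ) - t₀) +
        δ * (((a * v 0 - b * v 1 : ℤ) : ℝ) - ((a * x 0 - b * x 1 : ℤ) : ℝ)) := by ring
    have hδd : |δ * (((a * v 0 - b * v 1 : ℤ) : ℝ) - ((a * x 0 - b * x 1 : ℤ) : ℝ))| ≤ w / 192 := by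
      rw [abs_mul, abs_of_pos hδ]
      calc δ * |((a * v 0 - b * v 1 : ℤ) : ℝ) - ((a * x 0 - b * x 1 : ℤ) : ℝ)| ≤ δ * (n / 32) :=
            mul_le_mul_of_nonneg_left hd hδ.le
        _ = (n * δ) / 32 := by ring
        _ ≤ w / 192 := by linarith
    rw [e]
    exact (abs_add_le _ _).trans (by linarith)
  -- the level of `x` and of the bottom of the band
  have hlxR : δ * ((a * x 0 + b * x 1 : ℤ) : ℝ) = δ * k - 2 * δ := by rw [hlx]; push_cast; ring
  obtain ⟨hℓv₀1, hℓv₀2⟩ := abs_le.1 hℓv₀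
  obtain ⟨hτv₀1, hτv₀2⟩ := abs_le.1 hτv₀
  have h92₀ : 3 * Real.sqrt 2 * ((2 * m₀ : ℕ) : ℝ) * δ ≤ 9 * ((m₀ : ℝ) * δ) := three_sqrt_two_two_mul_le hδ.le
  refine ⟨?_, ?_, ?_⟩
  · intro v hv
    obtain ⟨h1, h2, h3⟩ := hv
    rw [hlx] at h2 h3
    have h2' : ((k : ℤ) : ℝ) - 2 - 3 * n ≤ ((a * v 0 + b * v 1 : ℤ) : ℝ) := by exact_mod_cast h2
    refine ⟨(hcol v h1).trans (by linarith), ?_, h3⟩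
    have : δ * (((k : ℤ) : ℝ) - 2 - 3 * n) ≤ δ * ((a * v 0 + b * v 1 : ℤ) : ℝ) := mul_le_mul_of_nonneg_left h2' hδ.le
    nlinarith
  · intro z hτz hℓz
    have hℓzR : δ * ((a * z 0 + b * z 1 : ℤ) : ℝ) = δ * k - 2 * δ - 3 * (n * δ) := by
      rw [hℓz, hlx]; push_cast; ring
    have hd := dist_le_level_add_column ha hb (meshPoint δ z) (meshPoint δ v₀)
    rw [level_meshPoint, level_meshPoint, column_meshPoint, column_meshPoint, hℓzR] at hd
    have hτ' := hcol z hτz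
    rw [abs_le] at hτ'
    have e1 : |δ * k - 2 * δ - 3 * (n * δ) - δ * ((a * v₀ 0 + b * v₀ 1 : ℤ) : ℝ)| ≤ 5 * δ := by
      rw [abs_le]; constructor <;> nlinarith
    have e2 : |δ * ((a * z 0 - b * z 1 : ℤ) : ℝ) - δ * ((a * v₀ 0 - b * v₀ 1 : ℤ) : ℝ)| ≤ w / 1000 + w / 192 + 2 * δ := by
      rw [abs_le]; constructor <;> linarith
    push_cast
    nlinarith
  · have hℓ := abs_level_sub_le ha hb (meshPoint δ x) (meshPoint δ v₀)
    rw [level_meshPoint, level_meshPoint, hlxR] at hℓ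
    have e1 : w / 2 - 5 * δ ≤ |δ * k - 2 * δ - δ * ((a * v₀ 0 + b * v₀ 1 : ℤ) : ℝ)| := by
      rw [le_abs]; left; nlinarith
    nlinarith

/-- **Registered ticket `stub_touch_glueJ`** (one-line form under which this helper file is filed on the crux item):
wall orientations square to one. [folklore] -/
theorem stub_touch_glueJ : ∀ (a b : ℤ), (a = 1 ∨ a = -1) → (b = 1 ∨ b = -1) → a * a = 1 ∧ b * b = 1 := by
  rintro a b (rfl | rfl) (rfl | rfl) <;> norm_num

end Summit.CriticalPhenomena.CardyFormulaZ2.Theorems.ParafermionFamiliesToSLESix.TouchLowerBound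

end
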